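import Mathlib
import Literature.MathematicalPhysics.QuantumManyBody.BoseEinsteinCondensation
import HarnessLib

/-!
# Route BECPhaseQuadratureSumRule — `SmoothPartner`, helper: the soft-ball potential

Helper file for item stmt-AtomisticToContinuum-12628 (`SmoothPartner`). The smooth-class witness is
the soft ball `v_s(r) = s ((R² − r²)₊)⁴`: here its elementary properties — measurable, finite range
`R`, bounded by `s R⁸`, `C²` as `x ↦ v_s(|x|)` on `ℝ³` (through the `C²` profile `t ↦ s (t₊)⁴`), and
the edge condition `‖D²ṽ_s(x)‖ ≤ Cₑ √ṽ_s(x)` (Faà di Bruno bound `norm_iteratedFDeriv_comp_le` for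
`(s t₊⁴) ∘ (R² − |x|²)`, with `|∂ⁱ(s t₊⁴)| ≤ s K t₊²` and `√(s t₊⁴) = √s t₊²`).
-/

noncomputable section

open MeasureTheory Set Filter Topology Metric
open scoped ENNReal NNReal

namespace Summit.AtomisticToContinuum.BoseEinsteinCondensation.Theorems

open Literature.MathematicalPhysics.QuantumManyBody.BoseGas

/-! ### The one-dimensional profile `t ↦ (t₊)ⁿ` -/

/-- `t ↦ (t₊)^{n+2}` is differentiable with derivative `(n+2) (t₊)^{n+1}`. [folklore] -/
theorem hasDerivAt_posPart_pow (n : ℕ) (t : ℝ) :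
    HasDerivAt (fun t : ℝ => (max t 0) ^ (n + 2)) ((n + 2 : ℝ) * (max t 0) ^ (n + 1)) t := by
  have hne : ∀ y : ℝ, y ≠ 0 →
      HasDerivAt (fun t : ℝ => (max t 0) ^ (n + 2)) ((n + 2 : ℝ) * (max y 0) ^ (n + 1)) y := by
    intro y hy
    rcases lt_or_gt_of_ne hy with hy | hy
    · have hev : (fun t : ℝ => (max t 0) ^ (n + 2)) =ᶠ[𝓝 y] fun _ => (0 : ℝ) := by
        filter_upwards [Iio_mem_nhds hy] with t ht
        rw [max_eq_right (le_of_lt ht), zero_pow (Nat.succ_ne_zero _)]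
      rw [max_eq_right hy.le, zero_pow (Nat.succ_ne_zero _), mul_zero]
      exact (hasDerivAt_const y (0 : ℝ)).congr_of_eventuallyEq hev
    · have hev : (fun t : ℝ => (max t 0) ^ (n + 2)) =ᶠ[𝓝 y] fun t => t ^ (n + 2) := by
        filter_upwards [Ioi_mem_nhds hy] with t ht
        rw [max_eq_left (le_of_lt ht)]
      rw [max_eq_left hy.le]
      refine ((hasDerivAt_pow (n + 2) y).congr_of_eventuallyEq hev).congr_deriv ?_
      rw [show n + 2 - 1 = n + 1 from rfl]
      push_cast
      ring
  have hcont : Continuous fun t : ℝ => (max t 0) ^ (n + 2) :=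
    (continuous_id.max continuous_const).pow _
  have hcont' : Continuous fun y : ℝ => (n + 2 : ℝ) * (max y 0) ^ (n + 1) :=
    continuous_const.mul ((continuous_id.max continuous_const).pow _)
  exact hasDerivAt_of_hasDerivAt_of_ne' hne hcont.continuousAt hcont'.continuousAt t

/-- `((t₊)⁴)' = 4 (t₊)³`. [folklore] -/
theorem hasDerivAt_posPart_pow_four (t : ℝ) :
    HasDerivAt (fun t : ℝ => (max t 0) ^ 4) (4 * (max t 0) ^ 3) t := by
  have h := hasDerivAt_posPart_pow 2 t
  norm_num at h
  exact h

/-- Derivative of `t ↦ s · 4 (t₊)³` (the first derivative of `s (t₊)⁴`):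
`s · 4 · 3 (t₊)²`. [folklore] -/
theorem hasDerivAt_deriv_smul_posPart_pow_four (s t : ℝ) :
    HasDerivAt (fun t : ℝ => s * (4 * (max t 0) ^ 3)) (s * (4 * (3 * (max t 0) ^ 2))) t := by
  have h := hasDerivAt_posPart_pow 1 t
  norm_num at h
  exact (h.const_mul 4).const_mul s

/-- First derivative of `t ↦ s (t₊)⁴`. [folklore] -/
theorem deriv_smul_posPart_pow_four (s : ℝ) :
    deriv (fun t : ℝ => s * (max t 0) ^ 4) = fun t => s * (4 * (max t 0) ^ 3) :=
  funext fun t => ((hasDerivAt_posPart_pow_four t).const_mul s).deriv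

/-- Second derivative of `t ↦ s (t₊)⁴`. [folklore] -/
theorem deriv_deriv_smul_posPart_pow_four (s : ℝ) :
    deriv (deriv (fun t : ℝ => s * (max t 0) ^ 4)) = fun t => s * (4 * (3 * (max t 0) ^ 2)) := by
  rw [deriv_smul_posPart_pow_four]
  exact funext fun t => (hasDerivAt_deriv_smul_posPart_pow_four s t).deriv

/-- `t ↦ s (t₊)⁴` is `C²`. [folklore] -/
theorem contDiff_two_smul_posPart_pow_four (s : ℝ) :
    ContDiff ℝ 2 (fun t : ℝ => s * (max t 0) ^ 4) := by
  rw [← one_add_one_eq_two, contDiff_succ_iff_deriv]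
  refine ⟨fun t => ((hasDerivAt_posPart_pow_four t).const_mul s).differentiableAt,
    fun h => absurd h WithTop.one_ne_top, ?_⟩
  rw [contDiff_one_iff_deriv, deriv_smul_posPart_pow_four]
  refine ⟨fun t => (hasDerivAt_deriv_smul_posPart_pow_four s t).differentiableAt, ?_⟩
  rw [← deriv_smul_posPart_pow_four, deriv_deriv_smul_posPart_pow_four]
  exact continuous_const.mul (continuous_const.mul (continuous_const.mul
    ((continuous_id.max continuous_const).pow _)))

/-- Edge-condition bound on the first three derivatives of `t ↦ s (t₊)⁴` on `(-∞, Q]`: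
`|∂ⁱ(s t₊⁴)| ≤ s (Q² + 4Q + 12) t₊²` for `i ≤ 2`. [folklore] -/
theorem norm_iteratedFDeriv_smul_posPart_pow_four_le {s Q t : ℝ} (hs : 0 ≤ s) (hQ : 0 ≤ Q)
    (ht : t ≤ Q) {i : ℕ} (hi : i ≤ 2) :
    ‖iteratedFDeriv ℝ i (fun t : ℝ => s * (max t 0) ^ 4) t‖ ≤
      s * (Q ^ 2 + 4 * Q + 12) * (max t 0) ^ 2 := by
  have hm0 : 0 ≤ max t 0 := le_max_right _ _
  have hmQ : max t 0 ≤ Q := max_le ht hQ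
  rw [norm_iteratedFDeriv_eq_norm_iteratedDeriv, Real.norm_eq_abs]
  interval_cases i
  · rw [iteratedDeriv_zero, abs_of_nonneg (by positivity)]
    have : (max t 0) ^ 4 = (max t 0) ^ 2 * (max t 0) ^ 2 := by ring
    rw [this, ← mul_assoc]
    refine mul_le_mul_of_nonneg_right ?_ (by positivity)
    refine mul_le_mul_of_nonneg_left ?_ hs
    calc (max t 0) ^ 2 ≤ Q ^ 2 := pow_le_pow_left₀ hm0 hmQ 2
      _ ≤ Q ^ 2 + 4 * Q + 12 := by nlinarith
  · rw [iteratedDeriv_one, deriv_smul_posPart_pow_four, abs_of_nonneg (by positivity)]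
    dsimp only
    have : s * (4 * (max t 0) ^ 3) = s * (4 * max t 0) * (max t 0) ^ 2 := by ring
    rw [this]
    refine mul_le_mul_of_nonneg_right ?_ (by positivity)
    refine mul_le_mul_of_nonneg_left ?_ hs
    nlinarith
  · rw [iteratedDeriv_succ, iteratedDeriv_one, deriv_deriv_smul_posPart_pow_four,
      abs_of_nonneg (by positivity)]
    dsimp only
    have : s * (4 * (3 * (max t 0) ^ 2)) = s * 12 * (max t 0) ^ 2 := by ring
    rw [this]
    refine mul_le_mul_of_nonneg_right ?_ (by positivity)
    refine mul_le_mul_of_nonneg_left ?_ hs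
    nlinarith

/-! ### The soft ball `v_s(r) = s ((R² − r²)₊)⁴` -/

/-- The soft ball is measurable. [folklore] -/
theorem measurable_softBall (R s : ℝ) :
    Measurable fun r : ℝ => ENNReal.ofReal (s * (max (R ^ 2 - r ^ 2) 0) ^ 4) :=
  (continuous_const.mul (((continuous_const.sub (continuous_id.pow 2)).max
    continuous_const).pow 4)).measurable.ennreal_ofReal

/-- The soft ball vanishes beyond `R ≥ 0`. [folklore] -/
theorem softBall_eq_zero {R s r : ℝ} (hR : 0 ≤ R) (hr : R < r) :
    ENNReal.ofReal (s * (max (R ^ 2 - r ^ 2) 0) ^ 4) = 0 := by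
  have : R ^ 2 < r ^ 2 := by nlinarith
  rw [max_eq_right (by linarith), zero_pow four_ne_zero, mul_zero, ENNReal.ofReal_zero]

/-- The soft ball is a repulsive finite-range potential. [folklore] -/
theorem isRepulsiveFiniteRange_softBall {R : ℝ} (hR : 0 ≤ R) (s : ℝ) :
    IsRepulsiveFiniteRange fun r : ℝ => ENNReal.ofReal (s * (max (R ^ 2 - r ^ 2) 0) ^ 4) :=
  ⟨measurable_softBall R s, R, fun _ hr => softBall_eq_zero hR hr⟩

/-- The soft ball is bounded by `s R⁸`. [folklore] -/
theorem softBall_le {R s : ℝ} (hs : 0 ≤ s) (r : ℝ) :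
    ENNReal.ofReal (s * (max (R ^ 2 - r ^ 2) 0) ^ 4) ≤ ((s * (R ^ 2) ^ 4).toNNReal : ℝ≥0∞) := by
  rw [← ENNReal.ofReal.eq_1]
  refine ENNReal.ofReal_le_ofReal (mul_le_mul_of_nonneg_left ?_ hs)
  exact pow_le_pow_left₀ (le_max_right _ _) (max_le (by nlinarith) (sq_nonneg R)) 4

/-- The radial function of the soft ball, in real terms. [folklore] -/
theorem toReal_softBall_norm {R s : ℝ} (hs : 0 ≤ s) :
    (fun x : Space => (ENNReal.ofReal (s * (max (R ^ 2 - ‖x‖ ^ 2) 0) ^ 4)).toReal) =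
      (fun t : ℝ => s * (max t 0) ^ 4) ∘ fun x : Space => R ^ 2 - ‖x‖ ^ 2 := by
  funext x
  simp only [Function.comp_apply]
  exact ENNReal.toReal_ofReal (by positivity)

/-- The soft ball is `C²` as a function on `ℝ³`. [folklore] -/
theorem contDiff_softBall {R s : ℝ} (hs : 0 ≤ s) :
    ContDiff ℝ 2 fun x : Space => (ENNReal.ofReal (s * (max (R ^ 2 - ‖x‖ ^ 2) 0) ^ 4)).toReal := by
  rw [toReal_softBall_norm hs]
  exact (contDiff_two_smul_posPart_pow_four s).comp (contDiff_const.sub (contDiff_norm_sq ℝ))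

/-- **Edge condition** for the soft ball: `‖D²ṽ(x)‖ ≤ Cₑ √ṽ(x)` on `ℝ³`. Faà di Bruno bound
(`norm_iteratedFDeriv_comp_le`) for `ṽ = (s t₊⁴) ∘ (R² − |x|²)`: the derivatives of the outer
function are `≤ s K t₊²`, `√ṽ = √s t₊²`, and the derivatives of `R² − |x|²` are bounded on the
ball by compactness. [folklore] -/
theorem edge_softBall {R s : ℝ} (hR : 0 ≤ R) (hs : 0 ≤ s) :
    ∃ Cₑ : ℝ, ∀ x : Space,
      ‖iteratedFDeriv ℝ 2 (fun x : Space =>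
          (ENNReal.ofReal (s * (max (R ^ 2 - ‖x‖ ^ 2) 0) ^ 4)).toReal) x‖ ≤
        Cₑ * Real.sqrt ((ENNReal.ofReal (s * (max (R ^ 2 - ‖x‖ ^ 2) 0) ^ 4)).toReal) := by
  set h : Space → ℝ := fun x => R ^ 2 - ‖x‖ ^ 2 with hh_def
  set G : ℝ → ℝ := fun t => s * (max t 0) ^ 4 with hG_def
  have hh : ContDiff ℝ 2 h := contDiff_const.sub (contDiff_norm_sq ℝ)
  have hG : ContDiff ℝ 2 G := contDiff_two_smul_posPart_pow_four s
  -- pointwise bound on the derivatives of `h`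
  set D : Space → ℝ := fun x =>
    max 1 (max ‖iteratedFDeriv ℝ 1 h x‖ ‖iteratedFDeriv ℝ 2 h x‖) with hD_def
  have hDc : Continuous D :=
    continuous_const.max ((hh.continuous_iteratedFDeriv (by norm_num)).norm.max
      (hh.continuous_iteratedFDeriv (by norm_num)).norm)
  have hD1 : ∀ x, 1 ≤ D x := fun x => le_max_left _ _
  obtain ⟨D₀, hD₀⟩ := (isCompact_closedBall (0 : Space) R).exists_bound_of_continuousOn
    hDc.continuousOn
  set K : ℝ := (R ^ 2) ^ 2 + 4 * R ^ 2 + 12 with hK_def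
  have hK0 : 0 ≤ K := by positivity
  -- the Faà di Bruno bound at every point
  have hFdB : ∀ x : Space,
      ‖iteratedFDeriv ℝ 2 (G ∘ h) x‖ ≤ 2 * (s * K * (max (h x) 0) ^ 2) * D x ^ 2 := by
    intro x
    have hx : h x ≤ R ^ 2 := by
      simp only [hh_def]
      nlinarith [sq_nonneg ‖x‖]
    have := norm_iteratedFDeriv_comp_le (n := 2) (N := 2) hG hh le_rfl x
      (C := s * K * (max (h x) 0) ^ 2) (D := D x)
      (fun i hi => norm_iteratedFDeriv_smul_posPart_pow_four_le hs (sq_nonneg R) hx hi)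
      (fun i h1 h2 => by
        interval_cases i
        · rw [pow_one]; exact (le_max_left _ _).trans (le_max_right _ _)
        · exact ((le_max_right _ _).trans (le_max_right _ _)).trans
            (le_self_pow₀ (hD1 x) two_ne_zero))
    simpa [Nat.factorial] using this
  refine ⟨2 * Real.sqrt s * K * D₀ ^ 2, fun x => ?_⟩
  have hsq : Real.sqrt ((G ∘ h) x) = Real.sqrt s * (max (h x) 0) ^ 2 := by
    simp only [Function.comp_apply, hG_def]
    rw [Real.sqrt_mul hs, show (max (h x) 0) ^ 4 = ((max (h x) 0) ^ 2) ^ 2 by ring,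
      Real.sqrt_sq (sq_nonneg _)]
  have hfun : (fun x : Space => (ENNReal.ofReal (s * (max (R ^ 2 - ‖x‖ ^ 2) 0) ^ 4)).toReal) =
      G ∘ h := toReal_softBall_norm hs
  have hpt : (ENNReal.ofReal (s * (max (R ^ 2 - ‖x‖ ^ 2) 0) ^ 4)).toReal = (G ∘ h) x :=
    ENNReal.toReal_ofReal (by positivity)
  rw [hfun, hpt, hsq]
  by_cases hxR : x ∈ closedBall (0 : Space) R
  · have hDx : D x ≤ D₀ := by
      have := hD₀ x hxR
      rwa [Real.norm_eq_abs, abs_of_pos (lt_of_lt_of_le one_pos (hD1 x))] at this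
    have hD0 : 0 ≤ D x := le_trans zero_le_one (hD1 x)
    calc ‖iteratedFDeriv ℝ 2 (G ∘ h) x‖ ≤ 2 * (s * K * (max (h x) 0) ^ 2) * D x ^ 2 := hFdB x
      _ ≤ 2 * (s * K * (max (h x) 0) ^ 2) * D₀ ^ 2 := by gcongr
      _ = 2 * Real.sqrt s * K * D₀ ^ 2 * (Real.sqrt s * (max (h x) 0) ^ 2) := by
          have hss : Real.sqrt s * Real.sqrt s = s := Real.mul_self_sqrt hs
          linear_combination (-(2 * K * (max (h x) 0) ^ 2 * D₀ ^ 2)) * hss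
  · have hxR' : R < ‖x‖ := by simpa using hxR
    have hneg : max (h x) 0 = 0 := by
      refine max_eq_right ?_
      simp only [hh_def]
      nlinarith
    have h0 : ‖iteratedFDeriv ℝ 2 (G ∘ h) x‖ ≤ 0 := by
      have := hFdB x
      rw [hneg] at this
      simpa using this
    calc ‖iteratedFDeriv ℝ 2 (G ∘ h) x‖ ≤ 0 := h0
      _ ≤ 2 * Real.sqrt s * K * D₀ ^ 2 * (Real.sqrt s * (max (h x) 0) ^ 2) := by
          rw [hneg]; simp

end Summit.AtomisticToContinuum.BoseEinsteinCondensation.Theorems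

end
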